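import Mathlib
import HarnessLib
import Summits.ValiantsHypothesis.ValiantsHypothesis.Theorems.MonotoneRestorationOrbitRestorationQPSubstClosure
import Summits.ValiantsHypothesis.ValiantsHypothesis.Theorems.MonotoneRestorationOrbitRestorationQPSmlAffineRestoration

/-!
# Quasi-polynomial orbit restorability is closed under the EQUIVARIANT AFFINE CHANGES OF VARIABLES
# `x_{ab} ↦ α x_{ab} + β R_a + γ C_b + δ U + ε` (route MonotoneRestoration, crux `OrbitRestorationQP` stmt-ValiantsHypothesis-18293,
# line `depth-three-rung`, stub A_∞ `stub_sigmaPiSigmaValue`)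

Namespace `Summit.ValiantsHypothesis.ValiantsHypothesis.Theorems.AffineSubst`.  Definition-free.

The `Sym_n × Sym_n`-equivariant affine endomorphisms of the space of `n × n` matrices are the five-parameter family
`φ(x_{ab}) = α x_{ab} + β R_a + γ C_b + δ U + ε` (`R_a = Σ_b x_{ab}`, `C_b = Σ_a x_{ab}`, `U = Σ_{ab} x_{ab}`).  They preserve
matrix symmetry, map affine forms to affine forms (so the depth-three slice `PDClass 1` up to constants), and — this file — the
conclusion of A_∞: by the substitution closure `ValueOrbit.qpOrbitRestorable_subst` (`…SubstClosure.lean`) over the explicit BASE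
derivation `{x_{ab}} ∪ {C ε} ∪ {R_a} ∪ {C_b} ∪ {U} ∪ {φ x_{ab}}` (every value supported on `≤ 2` indices, orbit `≤ (n+1)²`):

* `ren_affineSubst_comm` — `φ` commutes with the diagonal action of `Sym (Fin n)`;
* `exists_baseDerivation` — the base derivation with value orbits `≤ (n+1)²`;
* `succ_sq_le_qp` — `(n+1)² ≤ 2^((log₂ n + (c+3))^(c+3))`;
* `qpOrbitRestorable_affineSubst` — **`QPOrbitRestorable c n p → QPOrbitRestorable (c + 6) n (φ p)`** for all `α β γ δ ε`;
* `affineSubst_restoration` — family form: the image under level-dependent `φ_n` of a quasi-polynomially orbit-restorable family is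
  quasi-polynomially orbit-restorable (one constant);
* `affineColSml_affineSubst_restoration` — **NEW MEMBERS OF THE CERTIFIED CLASS**: `f n = φ_n (g n)` with `g` matrix-symmetric and
  affine column-set-multilinear `ΣΠΣ`-easy (`≤ n^c + c` product gates) is restorable — such `f n = Σ_t Π_b (β_{tb} + Σ_a α_{tba}
  (α x_{ab} + β' R_a + γ C_b + δ U + ε))` are in general neither column- nor row-set-multilinear.

Honest label: closure/transport of structure; every landed stratum of A_∞ becomes closed under the equivariant affine changes of
variables; no stub closed; VP ≠ VNP untouched. [folklore] [cite: DawarWilsenach2025, §3.3]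
-/

noncomputable section

open scoped Classical

-- `Summit.ValiantsHypothesis.ValiantsHypothesis.…` is the tree's single-conjunct layout (Sub = Summit).
set_option linter.dupNamespace false

namespace Summit.ValiantsHypothesis.ValiantsHypothesis.Theorems.AffineSubst

open MvPolynomial Finset Equiv Literature.Computability.AlgebraicComplexity OrbitRestorationQPDepthThreeRung
  Summit.ValiantsHypothesis.ValiantsHypothesis.Theorems

variable {n : ℕ}

/-! ### The substitution and its equivariance -/

/-- Row sums are permuted by the diagonal action. [folklore] -/
theorem ren_rowSum_eq (σ : Perm (Fin n)) (a : Fin n) :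
    ren σ (∑ b : Fin n, (X (a, b) : MvPolynomial (Fin n × Fin n) ℂ)) = ∑ b : Fin n, X (σ a, b) := by
  rw [map_sum]
  simp only [ren_X]
  exact Equiv.sum_comp σ (fun b => (X (σ a, b) : MvPolynomial (Fin n × Fin n) ℂ))

/-- Column sums are permuted by the diagonal action. [folklore] -/
theorem ren_colSum_eq (σ : Perm (Fin n)) (b : Fin n) :
    ren σ (∑ a : Fin n, (X (a, b) : MvPolynomial (Fin n × Fin n) ℂ)) = ∑ a : Fin n, X (a, σ b) := by
  rw [map_sum]
  simp only [ren_X]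
  exact Equiv.sum_comp σ (fun a => (X (a, σ b) : MvPolynomial (Fin n × Fin n) ℂ))

/-- The total sum is fixed by the diagonal action. [folklore] -/
theorem ren_totalSum_eq (σ : Perm (Fin n)) :
    ren σ (∑ a : Fin n, ∑ b : Fin n, (X (a, b) : MvPolynomial (Fin n × Fin n) ℂ)) = ∑ a : Fin n, ∑ b : Fin n, X (a, b) := by
  rw [map_sum]
  simp only [ren_rowSum_eq]
  exact Equiv.sum_comp σ (fun a => ∑ b : Fin n, (X (a, b) : MvPolynomial (Fin n × Fin n) ℂ))

/-- **The equivariant affine substitution commutes with the diagonal action.** [folklore] -/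
theorem ren_affineSubst_comm (α β γ δ ε : ℂ) (σ : Perm (Fin n)) (q : MvPolynomial (Fin n × Fin n) ℂ) :
    ren σ (aeval (fun x : Fin n × Fin n => C α * X x + C β * ∑ b : Fin n, X (x.1, b) + C γ * ∑ a : Fin n, X (a, x.2) +
        C δ * ∑ a : Fin n, ∑ b : Fin n, X (a, b) + C ε : Fin n × Fin n → MvPolynomial (Fin n × Fin n) ℂ) q) =
      aeval (fun x : Fin n × Fin n => C α * X x + C β * ∑ b : Fin n, X (x.1, b) + C γ * ∑ a : Fin n, X (a, x.2) +
        C δ * ∑ a : Fin n, ∑ b : Fin n, X (a, b) + C ε : Fin n × Fin n → MvPolynomial (Fin n × Fin n) ℂ) (ren σ q) := by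
  set φ : MvPolynomial (Fin n × Fin n) ℂ →ₐ[ℂ] MvPolynomial (Fin n × Fin n) ℂ :=
    aeval (fun x : Fin n × Fin n => C α * X x + C β * ∑ b : Fin n, X (x.1, b) + C γ * ∑ a : Fin n, X (a, x.2) +
        C δ * ∑ a : Fin n, ∑ b : Fin n, X (a, b) + C ε : Fin n × Fin n → MvPolynomial (Fin n × Fin n) ℂ) with hφ
  change ((ren σ).comp φ) q = (φ.comp (ren σ)) q
  congr 1
  refine MvPolynomial.algHom_ext fun x => ?_
  simp only [AlgHom.comp_apply, ren_X, hφ, aeval_X, map_add, map_mul, ren_C, ren_rowSum_eq, ren_colSum_eq, ren_totalSum_eq]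
  rfl

/-! ### The base derivation -/

/-- **THE BASE DERIVATION** of the equivariant affine substitution: the values `x_{ab}`, `C ε`, `R_a`, `C_b`, `U` and
`φ x_{ab} = α x_{ab} + β R_a + γ C_b + δ U + ε`, each supported on `≤ 2` indices, hence of orbit `≤ (n+1)²`. [folklore] -/
theorem exists_baseDerivation (α β γ δ ε : ℂ) :
    ∃ 𝒟₀ : ValueDerivation ℂ (Fin n × Fin n),
      (∀ x : Fin n × Fin n, (C α * X x + C β * ∑ b : Fin n, X (x.1, b) + C γ * ∑ a : Fin n, X (a, x.2) +
        C δ * ∑ a : Fin n, ∑ b : Fin n, X (a, b) + C ε : MvPolynomial (Fin n × Fin n) ℂ) ∈ 𝒟₀.S) ∧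
      ∀ q ∈ 𝒟₀.S, (Set.range fun σ : Perm (Fin n) => ren σ q).ncard ≤ (n + 1) ^ 2 := by
  -- the values
  let Rr : Fin n → MvPolynomial (Fin n × Fin n) ℂ := fun a => ∑ b : Fin n, X (a, b)
  let Cc : Fin n → MvPolynomial (Fin n × Fin n) ℂ := fun b => ∑ a : Fin n, X (a, b)
  let U : MvPolynomial (Fin n × Fin n) ℂ := ∑ a : Fin n, ∑ b : Fin n, X (a, b)
  let Φ : Fin n × Fin n → MvPolynomial (Fin n × Fin n) ℂ := fun x =>
    C α * X x + C β * Rr x.1 + C γ * Cc x.2 + C δ * U + C ε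
  let V : Finset (MvPolynomial (Fin n × Fin n) ℂ) := (univ : Finset (Fin n × Fin n)).image X ∪ {C ε}
  let W₁ : Finset (MvPolynomial (Fin n × Fin n) ℂ) := (univ : Finset (Fin n)).image Rr ∪ (univ : Finset (Fin n)).image Cc
  let W₂ : Finset (MvPolynomial (Fin n × Fin n) ℂ) := {U}
  let W₃ : Finset (MvPolynomial (Fin n × Fin n) ℂ) := (univ : Finset (Fin n × Fin n)).image Φ
  let S₀ : Finset (MvPolynomial (Fin n × Fin n) ℂ) := V ∪ W₁ ∪ W₂ ∪ W₃
  let rk : MvPolynomial (Fin n × Fin n) ℂ → ℕ := fun r =>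
    if r ∈ V then 0 else if r ∈ W₁ then 1 else if r ∈ W₂ then 2 else 3
  have memV : ∀ {r}, r ∈ V ↔ (∃ x, X x = r) ∨ r = C ε := by
    intro r; simp only [V, mem_union, mem_image, mem_univ, true_and, mem_singleton]
  have memW₁ : ∀ {r}, r ∈ W₁ ↔ (∃ a, Rr a = r) ∨ ∃ b, Cc b = r := by
    intro r; simp only [W₁, mem_union, mem_image, mem_univ, true_and]
  have memS₀ : ∀ {r}, r ∈ S₀ ↔ r ∈ V ∨ r ∈ W₁ ∨ r = U ∨ ∃ x, Φ x = r := by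
    intro r; simp only [S₀, W₂, W₃, mem_union, mem_singleton, mem_image, mem_univ, true_and, or_assoc]
  have X_mem : ∀ x, X x ∈ S₀ := fun x => memS₀.2 (Or.inl (memV.2 (Or.inl ⟨x, rfl⟩)))
  have Cε_mem : C ε ∈ S₀ := memS₀.2 (Or.inl (memV.2 (Or.inr rfl)))
  have R_mem : ∀ a, Rr a ∈ S₀ := fun a => memS₀.2 (Or.inr (Or.inl (memW₁.2 (Or.inl ⟨a, rfl⟩))))
  have C_mem : ∀ b, Cc b ∈ S₀ := fun b => memS₀.2 (Or.inr (Or.inl (memW₁.2 (Or.inr ⟨b, rfl⟩))))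
  have U_mem : U ∈ S₀ := memS₀.2 (Or.inr (Or.inr (Or.inl rfl)))
  have Φ_mem : ∀ x, Φ x ∈ S₀ := fun x => memS₀.2 (Or.inr (Or.inr (Or.inr ⟨x, rfl⟩)))
  have rk_X : ∀ x, rk (X x) = 0 := fun x => by simp only [rk, if_pos (memV.2 (Or.inl ⟨x, rfl⟩))]
  have rk_Cε : rk (C ε) = 0 := by simp only [rk, if_pos (memV.2 (Or.inr rfl))]
  have rk_R : ∀ a, rk (Rr a) ≤ 1 := fun a => by
    by_cases h : Rr a ∈ V
    · simp only [rk, if_pos h]; exact Nat.zero_le _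
    · simp only [rk, if_neg h, if_pos (memW₁.2 (Or.inl ⟨a, rfl⟩)), le_refl]
  have rk_C : ∀ b, rk (Cc b) ≤ 1 := fun b => by
    by_cases h : Cc b ∈ V
    · simp only [rk, if_pos h]; exact Nat.zero_le _
    · simp only [rk, if_neg h, if_pos (memW₁.2 (Or.inr ⟨b, rfl⟩)), le_refl]
  have rk_U : rk U ≤ 2 := by
    by_cases h : U ∈ V
    · simp only [rk, if_pos h]; omega
    by_cases h' : U ∈ W₁
    · simp only [rk, if_neg h, if_pos h']; omega
    · simp only [rk, if_neg h, if_neg h', W₂, mem_singleton, if_true, le_refl]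
  -- sum steps as multiset sums
  have sum_step_value : ∀ (ι : Type) (s : Finset ι) (g : ι → MvPolynomial (Fin n × Fin n) ℂ),
      (StepData.sum (s.val.map fun i => ((1 : ℂ), g i)) : StepData ℂ (Fin n × Fin n)).value = ∑ i ∈ s, g i := by
    intro ι s g
    simp only [StepData.value, Multiset.map_map, Function.comp_def, C_1, one_mul]
    rfl
  have sum_step_args : ∀ (ι : Type) (s : Finset ι) (g : ι → MvPolynomial (Fin n × Fin n) ℂ) (u : MvPolynomial _ ℂ),
      u ∈ (StepData.sum (s.val.map fun i => ((1 : ℂ), g i)) : StepData ℂ (Fin n × Fin n)).args → ∃ i ∈ s, g i = u := by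
    intro ι s g u hu
    simp only [StepData.args, Multiset.map_map, Function.comp_def, Multiset.mem_map, Finset.mem_val] at hu
    exact hu
  refine ⟨⟨S₀, rk, fun r hr => ?_⟩, fun x => Φ_mem x, fun q hq => ?_⟩
  · -- valid steps
    by_cases hV : r ∈ V
    · have hr0 : rk r = 0 := by simp only [rk, if_pos hV]
      rcases memV.1 hV with ⟨x, rfl⟩ | rfl
      · exact ⟨StepData.var x, ⟨rfl, fun u hu => by simp [StepData.args] at hu⟩⟩
      · exact ⟨StepData.const ε, ⟨rfl, fun u hu => by simp [StepData.args] at hu⟩⟩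
    by_cases hW₁ : r ∈ W₁
    · have hr1 : rk r = 1 := by simp only [rk, if_neg hV, if_pos hW₁]
      rcases memW₁.1 hW₁ with ⟨a, rfl⟩ | ⟨b, rfl⟩
      · refine ⟨StepData.sum ((univ : Finset (Fin n)).val.map fun b => ((1 : ℂ), X (a, b))), ⟨sum_step_value _ _ _, ?_⟩⟩
        intro u hu
        obtain ⟨b, -, rfl⟩ := sum_step_args _ _ _ u hu
        exact ⟨X_mem _, by rw [rk_X, hr1]; omega⟩
      · refine ⟨StepData.sum ((univ : Finset (Fin n)).val.map fun a => ((1 : ℂ), X (a, b))), ⟨sum_step_value _ _ _, ?_⟩⟩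
        intro u hu
        obtain ⟨a, -, rfl⟩ := sum_step_args _ _ _ u hu
        exact ⟨X_mem _, by rw [rk_X, hr1]; omega⟩
    by_cases hW₂ : r = U
    · subst hW₂
      have hr2 : rk U = 2 := by simp only [rk, if_neg hV, if_neg hW₁, W₂, mem_singleton, if_true]
      refine ⟨StepData.sum ((univ : Finset (Fin n)).val.map fun a => ((1 : ℂ), Rr a)), ⟨sum_step_value _ _ _, ?_⟩⟩
      intro u hu
      obtain ⟨a, -, rfl⟩ := sum_step_args _ _ _ u hu
      exact ⟨R_mem _, by rw [hr2]; exact Nat.lt_of_le_of_lt (rk_R a) (by omega)⟩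
    · have hW₂' : r ∉ W₂ := by simpa only [W₂, mem_singleton] using hW₂
      have hr3 : rk r = 3 := by simp only [rk, if_neg hV, if_neg hW₁, if_neg hW₂']
      obtain ⟨x, rfl⟩ : ∃ x, Φ x = r := by
        rcases memS₀.1 hr with h | h | h | h
        · exact absurd h hV
        · exact absurd h hW₁
        · exact absurd h hW₂
        · exact h
      refine ⟨StepData.sum ((α, X x) ::ₘ (β, Rr x.1) ::ₘ (γ, Cc x.2) ::ₘ (δ, U) ::ₘ {((1 : ℂ), C ε)}), ⟨?_, ?_⟩⟩
      · simp only [StepData.value, Multiset.map_cons, Multiset.map_singleton, Multiset.sum_cons, Multiset.sum_singleton,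
          C_1, one_mul, Φ]
        ring
      · intro u hu
        simp only [StepData.args, Multiset.map_cons, Multiset.map_singleton, Multiset.mem_cons, Multiset.mem_singleton] at hu
        rw [hr3]
        rcases hu with rfl | rfl | rfl | rfl | rfl
        · exact ⟨X_mem _, by rw [rk_X]; omega⟩
        · exact ⟨R_mem _, Nat.lt_of_le_of_lt (rk_R _) (by omega)⟩
        · exact ⟨C_mem _, Nat.lt_of_le_of_lt (rk_C _) (by omega)⟩
        · exact ⟨U_mem, Nat.lt_of_le_of_lt rk_U (by omega)⟩
        · exact ⟨Cε_mem, by rw [rk_Cε]; omega⟩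
  · -- orbit bounds: every value is supported on at most two indices
    have hsupp : ∀ r ∈ S₀, ∃ T : Finset (Fin n), T.card ≤ 2 ∧
        ∀ σ : Perm (Fin n), (∀ i ∈ T, σ i = i) → ren σ r = r := by
      intro r hr
      have hR : ∀ a (σ : Perm (Fin n)), σ a = a → ren σ (Rr a) = Rr a := fun a σ ha => by
        show ren σ (∑ b : Fin n, X (a, b)) = ∑ b : Fin n, X (a, b)
        rw [ren_rowSum_eq, ha]
      have hC : ∀ b (σ : Perm (Fin n)), σ b = b → ren σ (Cc b) = Cc b := fun b σ hb => by
        show ren σ (∑ a : Fin n, X (a, b)) = ∑ a : Fin n, X (a, b)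
        rw [ren_colSum_eq, hb]
      have hU : ∀ σ : Perm (Fin n), ren σ U = U := fun σ => ren_totalSum_eq σ
      rcases memS₀.1 hr with h | h | rfl | ⟨x, rfl⟩
      · rcases memV.1 h with ⟨x, rfl⟩ | rfl
        · refine ⟨{x.1, x.2}, card_le_two, fun σ hσ => ?_⟩
          have h1 : σ x.1 = x.1 := hσ _ (by simp)
          have h2 : σ x.2 = x.2 := hσ _ (by simp)
          rw [ren_X]
          exact congrArg X (Prod.ext h1 h2)
        · exact ⟨∅, by simp, fun σ _ => ren_C σ ε⟩
      · rcases memW₁.1 h with ⟨a, rfl⟩ | ⟨b, rfl⟩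
        · exact ⟨{a}, by simp, fun σ hσ => hR a σ (hσ a (mem_singleton_self a))⟩
        · exact ⟨{b}, by simp, fun σ hσ => hC b σ (hσ b (mem_singleton_self b))⟩
      · exact ⟨∅, by simp, fun σ _ => hU σ⟩
      · refine ⟨{x.1, x.2}, card_le_two, fun σ hσ => ?_⟩
        have h1 : σ x.1 = x.1 := hσ _ (by simp)
        have h2 : σ x.2 = x.2 := hσ _ (by simp)
        have hx : σ • x = x := Prod.ext h1 h2
        -- `Φ x = φ (X x)` and `φ` commutes with `ren σ`
        have hΦ : ∀ y : Fin n × Fin n, Φ y =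
            aeval (R := ℂ) (fun x : Fin n × Fin n => C α * X x + C β * ∑ b : Fin n, X (x.1, b) + C γ * ∑ a : Fin n, X (a, x.2) +
              C δ * ∑ a : Fin n, ∑ b : Fin n, X (a, b) + C ε : Fin n × Fin n → MvPolynomial (Fin n × Fin n) ℂ)
              (X y : MvPolynomial (Fin n × Fin n) ℂ) :=
          fun y => by rw [aeval_X]
        rw [hΦ, ren_affineSubst_comm, ren_X, hx]
    obtain ⟨T, hT2, hT⟩ := hsupp q hq
    exact (ValueOrbit.orbit_bounded_of_supported hT).trans (Nat.pow_le_pow_right (Nat.succ_pos n) hT2)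

/-! ### Restorability is closed under the substitution -/

/-- Arithmetic: `(n+1)² ≤ 2^((log₂ n + (c+3))^(c+3))`. [folklore] -/
theorem succ_sq_le_qp (n c : ℕ) : (n + 1) ^ 2 ≤ 2 ^ ((Nat.log 2 n + (c + 3)) ^ (c + 3)) := by
  have hL : n < 2 ^ (Nat.log 2 n + 1) := Nat.lt_pow_succ_log_self Nat.one_lt_two n
  generalize Nat.log 2 n = L at hL ⊢
  have h1 : n + 1 ≤ 2 ^ (L + 1) := hL
  have h2 : (n + 1) ^ 2 ≤ 2 ^ ((L + 1) * 2) := by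
    rw [pow_mul]
    exact Nat.pow_le_pow_left h1 2
  refine h2.trans (Nat.pow_le_pow_right (by norm_num) ?_)
  have h3 := ValueOrbit.exp_arith L c
  have h4 : (L + 1) * 2 ≤ 2 * ((L + c) ^ c + 2 * L + 2) := by
    have := Nat.zero_le ((L + c) ^ c)
    omega
  exact h4.trans h3

/-- **`QPOrbitRestorable` IS CLOSED UNDER THE EQUIVARIANT AFFINE CHANGES OF VARIABLES** (cost `c ↦ c + 6`): for every
`α β γ δ ε`, if `p` is `QPOrbitRestorable c n p` then so is `φ p`, `φ(x_{ab}) = α x_{ab} + β R_a + γ C_b + δ U + ε`, with constant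
`c + 6`. [folklore] -/
theorem qpOrbitRestorable_affineSubst {c : ℕ} {p : MvPolynomial (Fin n × Fin n) ℂ} (hp : QPOrbitRestorable c n p)
    (α β γ δ ε : ℂ) :
    QPOrbitRestorable (c + 6) n
      (aeval (fun x : Fin n × Fin n => C α * X x + C β * ∑ b : Fin n, X (x.1, b) + C γ * ∑ a : Fin n, X (a, x.2) +
        C δ * ∑ a : Fin n, ∑ b : Fin n, X (a, b) + C ε : Fin n × Fin n → MvPolynomial (Fin n × Fin n) ℂ) p) := by
  obtain ⟨𝒟₀, hbase, hS₀⟩ := exists_baseDerivation (n := n) α β γ δ ε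
  have hp' : QPOrbitRestorable (c + 3) n p := Restorable.qpOrbitRestorable_mono (by omega) hp
  have hS₀' : ∀ q ∈ 𝒟₀.S, (Set.range fun σ : Perm (Fin n) => ren σ q).ncard ≤ 2 ^ ((Nat.log 2 n + (c + 3)) ^ (c + 3)) :=
    fun q hq => (hS₀ q hq).trans (succ_sq_le_qp n c)
  exact ValueOrbit.qpOrbitRestorable_subst hp' _ (ren_affineSubst_comm α β γ δ ε) 𝒟₀ (fun x => by rw [aeval_X]; exact hbase x) hS₀'

/-- **Family form.**  The image of a quasi-polynomially orbit-restorable family under level-dependent equivariant affine changes of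
variables is quasi-polynomially orbit-restorable, with one constant. [folklore] -/
theorem affineSubst_restoration (f : (n : ℕ) → MvPolynomial (Fin n × Fin n) ℂ) (α β γ δ ε : ℕ → ℂ)
    (hf : ∃ c : ℕ, ∀ n : ℕ, QPOrbitRestorable c n (f n)) :
    ∃ c' : ℕ, ∀ n : ℕ, QPOrbitRestorable c' n
      (aeval (fun x : Fin n × Fin n => C (α n) * X x + C (β n) * ∑ b : Fin n, X (x.1, b) + C (γ n) * ∑ a : Fin n, X (a, x.2) +
        C (δ n) * ∑ a : Fin n, ∑ b : Fin n, X (a, b) + C (ε n) : Fin n × Fin n → MvPolynomial (Fin n × Fin n) ℂ) (f n)) := by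
  obtain ⟨c, hc⟩ := hf
  exact ⟨c + 6, fun n => qpOrbitRestorable_affineSubst (hc n) _ _ _ _ _⟩

/-- **NEW MEMBERS OF THE CERTIFIED CLASS OF A_∞.**  If `g` is a matrix-symmetric family with affine column-set-multilinear `ΣΠΣ`
circuits of at most `n^c + c` product gates (the landed stratum `SmlAffineRestoration.affineColSml_restoration`), then every family
`f n = φ_n (g n)` obtained from it by equivariant affine changes of variables is quasi-polynomially orbit-restorable; such `f n =
Σ_t Π_b (β_{tb} + Σ_a α_{tba} · (α' x_{ab} + β' R_a + γ' C_b + δ' U + ε'))` are in general neither column- nor row-set-multilinear.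
[folklore] -/
theorem affineColSml_affineSubst_restoration (g : (n : ℕ) → MvPolynomial (Fin n × Fin n) ℂ) (hsym : IsMatrixSymmetric g)
    (hg : ∃ c : ℕ, ∀ n : ℕ, ∃ (s : ℕ) (β : Fin s → Fin n → ℂ) (α : Fin s → Fin n → Fin n → ℂ), s ≤ n ^ c + c ∧
      g n = ∑ t : Fin s, ∏ b : Fin n, (C (β t b) + ∑ a : Fin n, C (α t b a) * X (a, b)))
    (α β γ δ ε : ℕ → ℂ) :
    ∃ c' : ℕ, ∀ n : ℕ, QPOrbitRestorable c' n
      (aeval (fun x : Fin n × Fin n => C (α n) * X x + C (β n) * ∑ b : Fin n, X (x.1, b) + C (γ n) * ∑ a : Fin n, X (a, x.2) +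
        C (δ n) * ∑ a : Fin n, ∑ b : Fin n, X (a, b) + C (ε n) : Fin n × Fin n → MvPolynomial (Fin n × Fin n) ℂ) (g n)) :=
  affineSubst_restoration g α β γ δ ε (SmlAffineRestoration.affineColSml_restoration g hsym hg)

end Summit.ValiantsHypothesis.ValiantsHypothesis.Theorems.AffineSubst

end
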